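import Mathlib
import HarnessLib
import Literature.NumberTheory.LFunctions.KMVMomentAsymptoticsBeyondDiagonal

/-!
# Collar lemmas for the recommended instance of the pair split of K_A
# (`pairs-beyond-family-size`, crux `PrimeLevelFamEdge.MomentsBeyondDiagonal`, stmt-Parity-20007)

Planner `ls-idea-lens-17` (regen g0), 2026-08-28 — answer to REF-E P-E2-1 (HOME/ls-idea-ref-5/card-verdicts.md
§«E b2»). The registered skeleton `Cruxes/MomentsBeyondDiagonal/Lines/pairs_beyond_family_size.lean`
(typer ls-idea-typ-1, commit 2330b57e30c7) proves the glue
`MomentsBeyondDiagonal_of_pairSplit (ω) : SubFirst → SubPairs ω → SubPairs (complCut ω) → KA` for EVERY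
cut family `ω`, and registers its stubs at the SHARP cut `hyperbolicCut zetaStar` (`m₁m₂ ≤ q̂^{3−Δ'}`).
The instance recommended to a lead prover is the SMOOTH COLLAR CUT below a FIXED exponent `2(1−ε)`:

  `collarCut ε = smoothHyperbolicCut (wCollar ε) (fun _ ↦ 2)`   (definitionally; see `collarCut_eq`),
  `wCollar ε x = Real.smoothTransition ((1 − ε − x)/ε)`       (`= 1` for `x ≤ 1 − 2ε`, `= 0` for `x ≥ 1 − ε`).

This file (Mathlib + the KMV vocabulary only; it does not import the unbuilt `Lines` module) CERTIFIES the
three facts a prover of Sub₂/Sub₃ uses first: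
* `collarCut_eq_one_of_le`  — BELOW carries full weight on `m₁m₂ ≤ q̂^{2(1−2ε)}`;
* `collarCut_eq_zero_of_le` — BELOW-weight VANISHES on `m₁m₂ ≥ q̂^{2(1−ε)}` (so the BELOW piece lives in
  `m₁m₂ < q̂^{2−2ε} ≍ q^{1−ε}`, KMV Lemma 3.3's hypothesis `m₁m₂ ≪ q^{1−δ}` with `δ = ε` UNIFORMLY on every
  window `(1, Δ]`), hence the ABOVE piece `1 − collarCut` is supported on `m₁m₂ > q̂^{2(1−2ε)}`: both
  `mᵢ ≥ q̂^{2−4ε−Δ'}` — the pairs beyond the family size `|S₂(q)*| ≍ q̂²` up to the margin `q̂^{4ε+(Δ'−1)}`;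
* `wCollar_contDiff`, `collarCut_mem_Icc` — the profile is `C^∞` with values in `[0,1]` (a smooth function
  of `log(m₁m₂)/log q̂`: each derivative gains a factor `1/log q̂` in any Mellin/Voronoi step).
Nothing here is a claim about moments; no summit statement is proved by this seat.
-/

namespace Summit.Parity.GeneralizedHardyLittlewood.Cruxes.MomentsBeyondDiagonal.PairsBeyondFamilySize.Collar

open Literature.NumberTheory.LFunctions

noncomputable section

/-- The collar profile: `1` on `(−∞, 1 − 2ε]`, `0` on `[1 − ε, ∞)`, smooth and monotone in between. -/
def wCollar (ε x : ℝ) : ℝ := Real.smoothTransition ((1 - ε - x) / ε)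

/-- The collar cut family at fixed exponent `2`: weight `wCollar ε (log(m₁m₂) / (2 log q̂))`
(= `smoothHyperbolicCut (wCollar ε) (fun _ ↦ 2)` of the registered line, unfolded). -/
def collarCut (ε : ℝ) : ℕ → ℝ → ℕ → ℕ → ℝ :=
  fun q _Δ' m₁ m₂ ↦ wCollar ε (Real.log ((m₁ * m₂ : ℕ) : ℝ) / (2 * Real.log (KMV2000.qhat q)))

/-- Literal agreement with the line's `smoothHyperbolicCut w ζ q Δ' m₁ m₂ = w (log(m₁m₂) / (ζ Δ' * log q̂))`
at `w = wCollar ε`, `ζ = fun _ ↦ 2`. -/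
theorem collarCut_eq (ε : ℝ) (q : ℕ) (Δ' : ℝ) (m₁ m₂ : ℕ) :
    collarCut ε q Δ' m₁ m₂ =
      wCollar ε (Real.log ((m₁ * m₂ : ℕ) : ℝ) / ((fun _ : ℝ ↦ (2 : ℝ)) Δ' * Real.log (KMV2000.qhat q))) :=
  rfl

theorem wCollar_eq_one_of_le {ε x : ℝ} (hε : 0 < ε) (hx : x ≤ 1 - 2 * ε) : wCollar ε x = 1 := by
  unfold wCollar
  apply Real.smoothTransition.one_of_one_le
  rw [le_div_iff₀ hε]
  linarith

theorem wCollar_eq_zero_of_le {ε x : ℝ} (hε : 0 < ε) (hx : 1 - ε ≤ x) : wCollar ε x = 0 := by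
  unfold wCollar
  apply Real.smoothTransition.zero_of_nonpos
  exact div_nonpos_of_nonpos_of_nonneg (by linarith) hε.le

theorem wCollar_mem_Icc (ε x : ℝ) : wCollar ε x ∈ Set.Icc (0 : ℝ) 1 :=
  ⟨Real.smoothTransition.nonneg _, Real.smoothTransition.le_one _⟩

theorem wCollar_contDiff (ε : ℝ) {n : ℕ∞} : ContDiff ℝ n (wCollar ε) := by
  have h : ContDiff ℝ n (fun x : ℝ ↦ (1 - ε - x) / ε) :=
    ((contDiff_const.sub contDiff_id).div_const ε)
  exact Real.smoothTransition.contDiff.comp h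

theorem collarCut_mem_Icc (ε : ℝ) (q : ℕ) (Δ' : ℝ) (m₁ m₂ : ℕ) :
    collarCut ε q Δ' m₁ m₂ ∈ Set.Icc (0 : ℝ) 1 :=
  wCollar_mem_Icc _ _

/-- **BELOW has full weight up to `q̂^{2(1−2ε)}`.** -/
theorem collarCut_eq_one_of_le {ε : ℝ} (hε : 0 < ε) {q : ℕ} (hq : 1 < KMV2000.qhat q) (Δ' : ℝ)
    {m₁ m₂ : ℕ} (hm : 1 ≤ m₁ * m₂)
    (h : ((m₁ * m₂ : ℕ) : ℝ) ≤ KMV2000.qhat q ^ (2 * (1 - 2 * ε))) :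
    collarCut ε q Δ' m₁ m₂ = 1 := by
  have hL : 0 < Real.log (KMV2000.qhat q) := Real.log_pos hq
  have hq0 : 0 < KMV2000.qhat q := lt_trans zero_lt_one hq
  have hm0 : (0 : ℝ) < ((m₁ * m₂ : ℕ) : ℝ) := by exact_mod_cast hm
  have hlog : Real.log ((m₁ * m₂ : ℕ) : ℝ) ≤ 2 * (1 - 2 * ε) * Real.log (KMV2000.qhat q) := by
    have := Real.log_le_log hm0 h
    rwa [Real.log_rpow hq0] at this
  apply wCollar_eq_one_of_le hε
  rw [div_le_iff₀ (by positivity)]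
  linarith

/-- **BELOW-weight vanishes from `q̂^{2(1−ε)}` on** (so ABOVE = `1 − collarCut` is `1` there). -/
theorem collarCut_eq_zero_of_le {ε : ℝ} (hε : 0 < ε) {q : ℕ} (hq : 1 < KMV2000.qhat q) (Δ' : ℝ)
    {m₁ m₂ : ℕ} (h : KMV2000.qhat q ^ (2 * (1 - ε)) ≤ ((m₁ * m₂ : ℕ) : ℝ)) :
    collarCut ε q Δ' m₁ m₂ = 0 := by
  have hL : 0 < Real.log (KMV2000.qhat q) := Real.log_pos hq
  have hq0 : 0 < KMV2000.qhat q := lt_trans zero_lt_one hq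
  have hpow : 0 < KMV2000.qhat q ^ (2 * (1 - ε)) := Real.rpow_pos_of_pos hq0 _
  have hlog : 2 * (1 - ε) * Real.log (KMV2000.qhat q) ≤ Real.log ((m₁ * m₂ : ℕ) : ℝ) := by
    have := Real.log_le_log hpow h
    rwa [Real.log_rpow hq0] at this
  apply wCollar_eq_zero_of_le hε
  rw [le_div_iff₀ (by positivity)]
  linarith

/-- The ABOVE piece of the collar split is supported beyond `q̂^{2(1−2ε)}`: if `1 − collarCut ≠ 0` then
`m₁m₂ > q̂^{2(1−2ε)}`. -/
theorem lt_of_compl_collarCut_ne_zero {ε : ℝ} (hε : 0 < ε) {q : ℕ} (hq : 1 < KMV2000.qhat q) (Δ' : ℝ)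
    {m₁ m₂ : ℕ} (hm : 1 ≤ m₁ * m₂) (h : 1 - collarCut ε q Δ' m₁ m₂ ≠ 0) :
    KMV2000.qhat q ^ (2 * (1 - 2 * ε)) < ((m₁ * m₂ : ℕ) : ℝ) := by
  by_contra hle
  exact h (by rw [collarCut_eq_one_of_le hε hq Δ' hm (not_lt.mp hle), sub_self])

end

end Summit.Parity.GeneralizedHardyLittlewood.Cruxes.MomentsBeyondDiagonal.PairsBeyondFamilySize.Collar
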